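import Summits.HodgeConjecture.CorCM.IrreducibleOddWeightsRightIdealsPivotFamilies
import Summits.HodgeConjecture.CorCM.IrreducibleOddWeightsRightIdealsPivotCMFields
import Summits.HodgeConjecture.CorCM.IrreducibleOddWeightsProductSpanConverse
import HarnessLib

/-!
# Right ideals, V b: families of CM fields over a common Galois pivot — `Σ_i dim Hg(A_i) − dim Hg(∏_i A_i) =
# Σ_i dim(w_iℚ[Gal(M/ℚ)]) − dim(Σ_i w_iℚ[Gal(M/ℚ)])`, additivity iff the Hecke modules are independent, Hodge side

COR-CM (cell `pub-hodgecm2`, binder seat `b16` gen 64, count-neutral claim RIGHT IDEALS, file R5b — CM-field dress of R5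
`IrreducibleOddWeightsRightIdealsPivotFamilies`; theorems only, no definition, no named fact, no `sorry`).  NEW as stated,
hence under `Summits/`.  HONEST FRAMING: an exact formula for the codimension of `Hg(∏_i A_i)` in `∏_i Hg(A_i)` for a
finite family of abelian varieties with complex multiplication whose CM fields share a Galois subfield, and its reading
on Hodge classes of products through the tree's Moonen–Zarhin equivalence; `HC_CM` is neither used nor asserted.

SETTING (R4 `…RightIdealsPivotCMFields`, gen 63 S5).  CM fields `K_i` (`i ∈ I` finite), CM types `Φ_i`, realisations
`A_i ⊨ (K_i; Φ_i)`; `M` GALOIS over `ℚ` with `j_i : M → K_i`, `z₀ : M → ℂ`; shadows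
`w_i(z) = 2·#{t ∈ Φ_i : t|_M = z} − [K_i:M]` on `Hom(M, ℂ)` and their HECKE MODULES `H_i = span{w_i(· ∘ δ) : δ ∈ Gal(M/ℚ)}`
(the right ideal `w_iℚ[Γ]`, `Γ = Gal(M/ℚ)`).  HYPOTHESIS (GL): for every slot `l`, the Galois closure `L_l` meets the
compositum `∏_{i≠l} L_i` of the other closures inside `z₀(M)`.

* §1 **`mem_closure_fixing_of_normalClosure_inf_iSup_le`** — the gluing lemma, family form: under (GL) at `l`, every
  automorphism of `ℂ` fixing `z₀(M)` pointwise is a product of one fixing every embedding of the `K_i`, `i ≠ l`, and one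
  fixing every embedding of `K_l` ([Lang2002, VI §1 Thm. 1.14]).
* §2 **`sum_cmTypeRank_add_one_add_finrank_iSup_eq`** — THE EXACT FAMILY FORMULA:
  `Σ_i cmTypeRank Φ_i + 1 + dim(Σ_i H_i) = cmFamilyRank Φ + |I| + Σ_i dim H_i`, i.e.
  **`Σ_i dim Hg(A_i) − dim Hg(∏_i A_i) = Σ_i dim(w_iℚ[Γ]) − dim(Σ_i w_iℚ[Γ])`**;
  **`cmFamilyRank_add_card_eq_iff_iSupIndep_hecke`** — `Hg(∏_i A_i) = ∏_i Hg(A_i)` IFF the Hecke modules `H_i` are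
  INDEPENDENT subspaces of `ℚ^{Hom(M,ℂ)}`.
* §3 HODGE SIDE: **`forall_hodgeClassesProductSpan_iff_iSupIndep_hecke`** — every Hodge class on every product
  `(⨁ A_{π₁ l}) × (⨁ A_{π₂ l})` with disjoint slot maps is a sum of products of Hodge classes iff the `H_i` are independent;
  `exists_not_hodgeClassesProductSpan_of_not_iSupIndep_hecke` — a dependence yields a mixed exceptional Hodge class.

## References

* [Kubota1965] T. Kubota, *On the field extension by complex multiplication*, Trans. AMS 118 (1965), §2 Lemma 2, §4.
* [Gordon1999HodgeAVSurvey] B. B. Gordon, *A survey of the Hodge conjecture for abelian varieties*, §3 Theorem (proof),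
  7.5–7.7, 9.4.3.
* [MoonenZarhin1999LowDim] B. Moonen, Yu. Zarhin, *Hodge classes on abelian varieties of low dimension*, §3 (3.1).
* [Lang2002] S. Lang, *Algebra*, VI §1 Thm. 1.14, V §2 Thm. 2.8.
* [Shimura1998] G. Shimura, *Abelian Varieties with Complex Multiplication and Modular Functions*, §8.1, §8.3.
-/

set_option autoImplicit false

noncomputable section

open scoped BigOperators Classical

open CategoryTheory CategoryTheory.Limits NumberField Module IntermediateField

namespace Summit.HodgeConjecture.CorCM

open Literature.NumberTheory.ComplexMultiplication
open Literature.AlgebraicGeometry.Motives (AbelianVariety CMType)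
open Literature.AlgebraicGeometry.Motives.AbelianVariety
open Literature.AlgebraicGeometry.HodgeTheory
open Literature.AlgebraicGeometry.ComplexMultiplication (IsCMTypeRealisation)
open Literature.AlgebraicGeometry.Pohlmann1968

/-! ### §1 The gluing lemma for a family -/

section Gluing

variable {I : Type} [Finite I] {K : I → Type} [∀ i, Field (K i)] [∀ i, NumberField (K i)] {M : Type} [Field M]

/-- **The gluing lemma, family form.**  If the Galois closure `L_l` meets the compositum of the other Galois closures
inside `z₀(M)`, every automorphism of `ℂ` fixing `z₀(M)` pointwise is `τ · (τ⁻¹ g)` with `τ` fixing every embedding of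
every `K_i`, `i ≠ l`, and `τ⁻¹ g` fixing every embedding of `K_l`. [cite: Lang2002, VI §1 Thm. 1.14 and V §2 Thm. 2.8] -/
theorem mem_closure_fixing_of_normalClosure_inf_iSup_le (l : I) (z₀ : M →+* ℂ)
    (hmeet : ∀ z : ℂ, z ∈ normalClosure ℚ (K l) ℂ →
      z ∈ (⨆ i : {i : I // i ≠ l}, normalClosure ℚ (K i.1) ℂ) → z ∈ Set.range z₀)
    {g : ℂ ≃+* ℂ} (hg : ∀ m : M, g (z₀ m) = z₀ m) :
    g ∈ Subgroup.closure ({s : ℂ ≃+* ℂ | ∀ x : K l →+* ℂ, s • x = x} ∪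
      {s : ℂ ≃+* ℂ | ∀ i, i ≠ l → ∀ x : K i →+* ℂ, s • x = x}) := by
  haveI : ∀ i : I, @Normal ℚ ↥(normalClosure ℚ (K i) ℂ) _ _ (IntermediateField.algebra' _) :=
    normal_normalClosure_complex
  obtain ⟨τ, hA, hB⟩ := exists_ringEquiv_apply_eq_of_normal (A := normalClosure ℚ (K l) ℂ)
    (B := ⨆ i : {i : I // i ≠ l}, normalClosure ℚ (K i.1) ℂ) g (fun x h₀ h₁ => by
      obtain ⟨m, rfl⟩ := hmeet x h₀ h₁
      exact hg m)
  have hτ : τ ∈ ({s : ℂ ≃+* ℂ | ∀ x : K l →+* ℂ, s • x = x} ∪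
      {s : ℂ ≃+* ℂ | ∀ i, i ≠ l → ∀ x : K i →+* ℂ, s • x = x}) :=
    Or.inr fun i hi x => RingHom.ext fun a => by
      rw [ringEquiv_smul_apply]
      exact hB _ (le_iSup (fun i : {i : I // i ≠ l} => normalClosure ℚ (K i.1) ℂ) ⟨i, hi⟩
        (apply_mem_normalClosure i x a))
  have hτg : τ⁻¹ * g ∈ ({s : ℂ ≃+* ℂ | ∀ x : K l →+* ℂ, s • x = x} ∪
      {s : ℂ ≃+* ℂ | ∀ i, i ≠ l → ∀ x : K i →+* ℂ, s • x = x}) :=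
    Or.inl fun x => RingHom.ext fun a => by
      rw [ringEquiv_smul_apply]
      change τ.symm (g (x a)) = x a
      rw [RingEquiv.symm_apply_eq]
      exact (hA _ (apply_mem_normalClosure l x a)).symm
  rw [show g = τ * (τ⁻¹ * g) by group]
  exact Subgroup.mul_mem _ (Subgroup.subset_closure hτ) (Subgroup.subset_closure hτg)

end Gluing

/-! ### §2 The exact family formula over a common Galois pivot -/

section Rank

variable {I : Type} [Fintype I] {K : I → Type} [∀ i, Field (K i)] [∀ i, NumberField (K i)] [∀ i, IsCMField (K i)]
  {M : Type} [Field M] [NumberField M]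

/-- **THE EXACT FAMILY FORMULA OVER A COMMON GALOIS PIVOT.**  CM fields `K_i`, CM types `Φ_i`; `M` Galois over `ℚ` with
`j_i : M → K_i`, `z₀ : M → ℂ`; hypothesis (GL): every Galois closure `L_l` meets the compositum of the others inside
`z₀(M)`.  Then `Σ_i cmTypeRank Φ_i + 1 + dim(Σ_i H_i) = cmFamilyRank Φ + |I| + Σ_i dim H_i` for the Hecke modules
`H_i = span{w_i(· ∘ δ) : δ ∈ Gal(M/ℚ)}` of the shadows — i.e. **`Σ_i dim Hg(A_i) − dim Hg(∏_i A_i) =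
Σ_i dim(w_iℚ[Γ]) − dim(Σ_i w_iℚ[Γ])`**, `Γ = Gal(M/ℚ)`.
[cite: Kubota1965, §2 Lemma 2 and §4] [cite: Gordon1999HodgeAVSurvey, §3 Theorem (proof), 7.5–7.7 and 9.4.3]
[cite: Lang2002, VI §1 Thm. 1.14] -/
theorem sum_cmTypeRank_add_one_add_finrank_iSup_eq [IsGalois ℚ M] [Nonempty I] (Φ : ∀ i, CMType (K i))
    (j : ∀ i, M →+* K i) (z₀ : M →+* ℂ)
    (hmeet : ∀ (l : I) (z : ℂ), z ∈ normalClosure ℚ (K l) ℂ →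
      z ∈ (⨆ i : {i : I // i ≠ l}, normalClosure ℚ (K i.1) ℂ) → z ∈ Set.range z₀) :
    (∑ i, cmTypeRank (Φ i)) + 1 +
        Module.finrank ℚ (⨆ i, Submodule.span ℚ (Set.range fun δ : M ≃ₐ[ℚ] M => fun z : M →+* ℂ =>
          ∑ t ∈ Finset.univ.filter (fun t : K i →+* ℂ => t.comp (j i) = z.comp (δ : M →+* M)),
            antiVec (Φ i).1 (1 : ℂ ≃+* ℂ) t) : Submodule ℚ ((M →+* ℂ) → ℚ)) =
      CMAlgebra.cmFamilyRank Φ + Fintype.card I +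
        ∑ i, Module.finrank ℚ (Submodule.span ℚ (Set.range fun δ : M ≃ₐ[ℚ] M => fun z : M →+* ℂ =>
          ∑ t ∈ Finset.univ.filter (fun t : K i →+* ℂ => t.comp (j i) = z.comp (δ : M →+* M)),
            antiVec (Φ i).1 (1 : ℂ ≃+* ℂ) t)) := by
  haveI : ∀ i, Nonempty (K i →+* ℂ) := fun i => inferInstance
  haveI := isPretransitive_ringEquiv_complex (K := M)
  refine IrrOdd.sum_typeRank_add_one_add_finrank_iSup_span_precomp_eq (G := ℂ ≃+* ℂ) (E := fun i => K i →+* ℂ)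
    (Φ := fun i => (Φ i).1) (fun i => isCMTypeWith_conj (Φ i)) (fun i (t : K i →+* ℂ) => t.comp (j i))
    (fun _ _ _ => RingHom.ext fun _ => rfl) (Subgroup.closure {g : ℂ ≃+* ℂ | ∀ m : M, g (z₀ m) = z₀ m})
    (fun i x x' hxx' => ?_) (fun l => ?_)
    (fun (δ : M ≃ₐ[ℚ] M) (z : M →+* ℂ) => z.comp (δ : M →+* M)) (fun _ _ _ => RingHom.ext fun _ => rfl) z₀
    (fun z => exists_comp_algEquiv_eq z z₀) (fun z => MulAction.exists_smul_eq (ℂ ≃+* ℂ) z₀ z)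
  · obtain ⟨g, hg, hgx⟩ := exists_smul_eq_of_comp_eq (j i) z₀ hxx'.symm
    exact ⟨g, Subgroup.subset_closure hg, hgx⟩
  · exact (Subgroup.closure_le _).2 fun g hg => mem_closure_fixing_of_normalClosure_inf_iSup_le l z₀ (hmeet l) hg

/-- **`Hg(∏_i A_i) = ∏_i Hg(A_i)` IFF THE HECKE MODULES OF THE SHADOWS ARE INDEPENDENT** (same hypotheses).
[cite: Kubota1965, §2 Lemma 2 and §4] [cite: Gordon1999HodgeAVSurvey, §3 Theorem and 7.5–7.7] -/
theorem cmFamilyRank_add_card_eq_iff_iSupIndep_hecke [IsGalois ℚ M] [Nonempty I] (Φ : ∀ i, CMType (K i))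
    (j : ∀ i, M →+* K i) (z₀ : M →+* ℂ)
    (hmeet : ∀ (l : I) (z : ℂ), z ∈ normalClosure ℚ (K l) ℂ →
      z ∈ (⨆ i : {i : I // i ≠ l}, normalClosure ℚ (K i.1) ℂ) → z ∈ Set.range z₀) :
    CMAlgebra.cmFamilyRank Φ + Fintype.card I = (∑ i, cmTypeRank (Φ i)) + 1 ↔
      iSupIndep fun i => Submodule.span ℚ (Set.range fun δ : M ≃ₐ[ℚ] M => fun z : M →+* ℂ =>
        ∑ t ∈ Finset.univ.filter (fun t : K i →+* ℂ => t.comp (j i) = z.comp (δ : M →+* M)),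
          antiVec (Φ i).1 (1 : ℂ ≃+* ℂ) t) := by
  rw [← IrrOdd.finrank_iSup_eq_sum_finrank_iff_iSupIndep]
  have := sum_cmTypeRank_add_one_add_finrank_iSup_eq Φ j z₀ hmeet
  omega

end Rank

/-! ### §3 The Hodge side -/

section Hodge

variable {I : Type} [Fintype I] {K : I → Type} [∀ i, Field (K i)] [∀ i, NumberField (K i)]
  [∀ i, IsCMField (K i)] {M : Type} [Field M] [NumberField M]
  {Φ : ∀ i, CMType (K i)} {A : I → AbelianVariety ℂ} {ιA : ∀ i, 𝓞 (K i) →+* End (A i)}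
  {θ : ∀ i, K i →+* Module.End ℂ (complexBetti (A i).X 1)}

/-- **EVERY HODGE CLASS ON EVERY DISJOINT PRODUCT OF COPIES IS A SUM OF PRODUCTS ⟺ THE HECKE MODULES OF THE SHADOWS
ARE INDEPENDENT** (common Galois pivot, hypothesis (GL)). [cite: MoonenZarhin1999LowDim, §3 (3.1)]
[cite: Kubota1965, §2 Lemma 2] [cite: Gordon1999HodgeAVSurvey, 7.5–7.7 and 9.4.3] -/
theorem forall_hodgeClassesProductSpan_iff_iSupIndep_hecke [IsGalois ℚ M] [Nonempty I] (j : ∀ i, M →+* K i)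
    (z₀ : M →+* ℂ) (hmeet : ∀ (l : I) (z : ℂ), z ∈ normalClosure ℚ (K l) ℂ →
      z ∈ (⨆ i : {i : I // i ≠ l}, normalClosure ℚ (K i.1) ℂ) → z ∈ Set.range z₀)
    (hA : ∀ i, IsCMTypeRealisation (Φ i) (A i) (ιA i) (θ i)) :
    (∀ (N₁ N₂ : ℕ) [NeZero N₁] [NeZero N₂] (π₁ : Fin N₁ → I) (π₂ : Fin N₂ → I), (∀ l₁ l₂, π₁ l₁ ≠ π₂ l₂) →
        HodgeClassesProductSpan (⨁ fun l => A (π₁ l)) (⨁ fun l => A (π₂ l))) ↔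
      iSupIndep fun i => Submodule.span ℚ (Set.range fun δ : M ≃ₐ[ℚ] M => fun z : M →+* ℂ =>
        ∑ t ∈ Finset.univ.filter (fun t : K i →+* ℂ => t.comp (j i) = z.comp (δ : M →+* M)),
          antiVec (Φ i).1 (1 : ℂ ≃+* ℂ) t) :=
  (cmFamilyRank_add_card_eq_iff_forall_hodgeClassesProductSpan hA).symm.trans
    (cmFamilyRank_add_card_eq_iff_iSupIndep_hecke Φ j z₀ hmeet)

/-- **A dependence among the Hecke modules of the shadows ⟹ a MIXED exceptional Hodge class** on some
`(⨁ A_{π₁ l}) × (⨁ A_{π₂ l})` with disjoint slot maps. [cite: MoonenZarhin1999LowDim, Thm. (0.1) (a) and §3 (3.1)] -/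
theorem exists_not_hodgeClassesProductSpan_of_not_iSupIndep_hecke [IsGalois ℚ M] [Nonempty I] (j : ∀ i, M →+* K i)
    (z₀ : M →+* ℂ) (hmeet : ∀ (l : I) (z : ℂ), z ∈ normalClosure ℚ (K l) ℂ →
      z ∈ (⨆ i : {i : I // i ≠ l}, normalClosure ℚ (K i.1) ℂ) → z ∈ Set.range z₀)
    (hA : ∀ i, IsCMTypeRealisation (Φ i) (A i) (ιA i) (θ i))
    (hdep : ¬ iSupIndep fun i => Submodule.span ℚ (Set.range fun δ : M ≃ₐ[ℚ] M => fun z : M →+* ℂ =>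
        ∑ t ∈ Finset.univ.filter (fun t : K i →+* ℂ => t.comp (j i) = z.comp (δ : M →+* M)),
          antiVec (Φ i).1 (1 : ℂ ≃+* ℂ) t)) :
    ∃ (N₁ N₂ : ℕ) (_ : NeZero N₁) (_ : NeZero N₂) (π₁ : Fin N₁ → I) (π₂ : Fin N₂ → I),
      (∀ l₁ l₂, π₁ l₁ ≠ π₂ l₂) ∧ ¬ HodgeClassesProductSpan (⨁ fun l => A (π₁ l)) (⨁ fun l => A (π₂ l)) :=
  exists_not_hodgeClassesProductSpan_of_cmFamilyRank_add_card_ne hA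
    fun h => hdep ((cmFamilyRank_add_card_eq_iff_iSupIndep_hecke Φ j z₀ hmeet).1 h)

end Hodge

end Summit.HodgeConjecture.CorCM

end
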